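import Literature.Analysis.FluidPDE.ElgindiAngularEquationLink
import Literature.Analysis.FluidPDE.ElgindiAngularLevelIBP
import Literature.Analysis.FluidPDE.ElgindiPolarRadialCommutation
import Literature.Analysis.FluidPDE.ElgindiPolarEnergyWeighted
import HarnessLib

/-!
# The datum of the level-`k` angular estimate in terms of `F` and radial derivatives
([Elgindi2021] §7.3 Steps 3–5, §7.4; [ElgindiGhoulMasmoudi2021] §6 Theorem 3)

Topic `Literature/Analysis/FluidPDE`. Proof file (everything proved, no definitions, no named
facts) on the proof path of the named fact
`Literature.Analysis.FluidPDE.Elgindi.ElgindiGhoulMasmoudi2021_stabilityCore`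
(`ElgindiStabilityDecomposition.lean`). T. M. Elgindi, Ann. of Math. 194 (2021) =
arXiv:1904.04795, §7.3 Step 3 (p. 22): "we can rewrite (7.1) in the following convenient form:
`L(Ψ) = −α²(R∂_R)²Ψ − 5αR∂_RΨ − ∂_θθΨ + ∂_θ(tan(θ)Ψ) − 6Ψ = F`. […] Consequently,
`L(D_R^kΨ) = D_R^kF`", and Step 4 (p. 22): "`−∂_θθΨ + ∂_θ(tan(θ)Ψ) = F₁`, where we know from the
preceding steps that `|F₁ w/sin(2θ)^{η/2}| ≤ C|F w/sin(2θ)^{η/2}|`"; [ElgindiGhoulMasmoudi2021] §6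
(p. 15): "`−∂_θθΨ + ∂_θ(tan(θ)Ψ) = G`, for `|G|_{𝓗ᵏ} ≤ C_k|F|_{𝓗ᵏ}`".

For the a-priori class `Ψ = cos θχ` and its radial derivatives `Ψ_j = D_R^jΨ = cos θ·D_R^jχ`, the
datum `A_{k,j} = −∂_θ^{k+2}Ψ_j + ∂_θ^{k+1}(sin θ D_R^jχ)` of the level-`k` angular estimate
(`ElgindiAngularLevelEstimate.lean`) is `∂_θ^k G_j` with
`G_j = D_R^jF + α²Ψ_{j+2} + 5αΨ_{j+1} + 6Ψ_j` on the open strip (`F = L(Ψ)`, represented by its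
smooth extension `gF`). This file proves the resulting bound

  `∫∫ W A_{k,j}² s^r ≤ 4∫∫ W(∂^kD_R^j gF)²s^r + 4α⁴∫∫ W(∂^kΨ_{j+2})²s^r + 100α²∫∫ W(∂^kΨ_{j+1})²s^r + 144∫∫ W(∂^kΨ_j)²s^r`

(`angular_data_bound`), with the supporting facts: the smooth representative of `L(Ψ)`
(`ellipticOp_eq_smoothRep`, its regularity and support), `D_R^j(cos θχ) = cos θ D_R^jχ`,
`L(D_R^jΨ) = D_R^jL(Ψ)` on the strip, `α²R²∂_RRΨ_j + α(5+α)R∂_RΨ_j = α²Ψ_{j+2} + 5αΨ_{j+1}`, and a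
reusable integrability lemma for `W(R)·g·sin(2θ)^r` (`integrable_weight_mul_rpow`).
-/

noncomputable section

open MeasureTheory Set Real Filter Function Finset
open _root_.Topology

namespace Literature.Analysis.FluidPDE

namespace Elgindi

/-! ### Plumbing: integrability against `W(R)·sin(2θ)^r` -/

/-- `W(R)·g·sin(2θ)^r` is integrable on the plane for `g` continuous, compactly supported inside
`R > 0`, `W` continuous on `(0,∞)` and `r ≥ 0`. [folklore] -/
theorem integrable_weight_mul_rpow {W : ℝ → ℝ} (hWc : ContinuousOn W (Ioi 0)) {g : ℝ × ℝ → ℝ} (hg : Continuous g)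
    (hgs : HasCompactSupport g) (hgpos : ∀ p ∈ tsupport g, 0 < p.1) {r : ℝ} (hr : 0 ≤ r) :
    Integrable fun p : ℝ × ℝ => W p.1 * g p * Real.sin (2 * p.2) ^ r := by
  obtain ⟨a, ha, hva⟩ := exists_pos_forall_fst_lt_eq_zero hgs hgpos
  have cρ : Continuous fun θ : ℝ => Real.sin (2 * θ) ^ r := continuous_sin_two_mul_rpow hr
  have hc : Continuous fun p : ℝ × ℝ => W p.1 * (g p * Real.sin (2 * p.2) ^ r) :=
    continuous_weight_mul₂ hWc (hg.mul (cρ.comp continuous_snd)) ha fun p hp => by simp [hva p hp]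
  have hc' : Continuous fun p : ℝ × ℝ => W p.1 * g p * Real.sin (2 * p.2) ^ r := hc.congr fun p => by ring
  refine hc'.integrable_of_hasCompactSupport (hgs.mono fun p hp => ?_)
  contrapose! hp
  simp only [mem_support, ne_eq, not_not] at hp ⊢
  simp [hp]

/-- Support control for a derived integrand: if `g` vanishes wherever `X` does, the support
hypotheses transfer. [folklore] -/
theorem tsupport_subset_of_eq_zero {X g : ℝ × ℝ → ℝ} (h : ∀ p, X p = 0 → g p = 0) : tsupport g ⊆ tsupport X := by
  refine closure_minimal (fun p hp => subset_closure ?_) (isClosed_tsupport X)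
  contrapose! hp
  simp only [mem_support, ne_eq, not_not] at hp ⊢
  exact h p hp

/-- Compact support and positivity transfer. [folklore] -/
theorem hasCompactSupport_of_eq_zero {X g : ℝ × ℝ → ℝ} (hX : HasCompactSupport X) (h : ∀ p, X p = 0 → g p = 0) :
    HasCompactSupport g :=
  hX.mono fun p hp => by
    contrapose! hp
    simp only [mem_support, ne_eq, not_not] at hp ⊢
    exact h p hp

/-! ### The a-priori class under `D_R^j` -/

/-- `D_R^j(cos θχ) = cos θ·D_R^jχ` for `χ ∈ Cʲ`. [folklore] -/
theorem iterate_Dz_cosProfile (j : ℕ) : ∀ {χ : ℝ → ℝ → ℝ}, ContDiff ℝ (j : ℕ) (uncurry χ) →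
    Dz^[j] (fun R θ => Real.cos θ * χ R θ) = fun R θ => Real.cos θ * (Dz^[j] χ) R θ := by
  induction j with
  | zero => intro χ _; rfl
  | succ j ih =>
    intro χ hχ
    have hχ1 : ContDiff ℝ 1 (uncurry χ) := hχ.of_le (by exact_mod_cast Nat.le_add_left 1 j)
    have hχ' : ContDiff ℝ (j : ℕ) (uncurry (Dz χ)) := by
      refine contDiff_Dz_of_contDiff ?_
      exact_mod_cast hχ
    rw [Function.iterate_succ_apply, Function.iterate_succ_apply, Dz_cosProfile hχ1, ih hχ']

/-- Iterates of `D_R` keep the support inside `R > 0`. [folklore] -/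
theorem tsupport_iterate_Dz_pos {χ : ℝ → ℝ → ℝ} (hpos : ∀ p ∈ tsupport (uncurry χ), 0 < p.1) (j : ℕ) :
    ∀ p ∈ tsupport (uncurry (Dz^[j] χ)), 0 < p.1 := fun p hp => hpos p (tsupport_iterate_Dz_subset j hp)

/-- Iterates of `∂_θ` do not enlarge the support. [folklore] -/
theorem tsupport_iterate_dθ_subset {g : ℝ → ℝ → ℝ} (n : ℕ) : tsupport (uncurry (dθ^[n] g)) ⊆ tsupport (uncurry g) := by
  induction n generalizing g with
  | zero => simp
  | succ n ih => rw [Function.iterate_succ_apply]; exact (ih (g := dθ g)).trans (tsupport_dθ_subset' g)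

/-- **`L(D_R^jΨ) = D_R^jL(Ψ)` on the open strip** for `Ψ ∈ C^{j+3}`. [cite: Elgindi2021, §7.3 proof of Proposition 7.7, Step 3, "L(D_R^kΨ) = D_R^kF" (p. 22 of arXiv:1904.04795)] -/
theorem ellipticOp_iterate_Dz (α : ℝ) (j : ℕ) : ∀ {Ψ : ℝ → ℝ → ℝ}, ContDiff ℝ ((j + 3 : ℕ) : WithTop ℕ∞) (uncurry Ψ) →
    ∀ p ∈ strip, ellipticOp α (Dz^[j] Ψ) p.1 p.2 = (Dz^[j] (ellipticOp α Ψ)) p.1 p.2 := by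
  induction j with
  | zero => intro Ψ _ p _; rfl
  | succ j ih =>
    intro Ψ hΨ p hp
    have hΨ3 : ContDiff ℝ 3 (uncurry Ψ) := hΨ.of_le (by exact_mod_cast (show 3 ≤ j + 1 + 3 by omega))
    have hΨ' : ContDiff ℝ ((j + 3 : ℕ) : WithTop ℕ∞) (uncurry (Dz Ψ)) := by
      refine contDiff_Dz_of_contDiff ?_
      have e : ((j + 1 + 3 : ℕ) : WithTop ℕ∞) = ((j + 3 : ℕ) : WithTop ℕ∞) + 1 := by push_cast; ring
      rw [← e]; exact hΨ
    rw [Function.iterate_succ_apply, Function.iterate_succ_apply, ih hΨ' p hp]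
    exact iterate_Dz_congr (fun q hq => ellipticOp_Dz α hΨ3 hq) j p hp

/-- `α²R²∂_RRΦ + α(5+α)R∂_RΦ = α²D_R²Φ + 5αD_RΦ` for `Φ ∈ C²` (`R²∂_RR = D_R² − D_R`). [cite: Elgindi2021, §7.3 proof of Proposition 7.7, Step 3, "L(Ψ) = −α²(R∂_R)²Ψ − 5αR∂_RΨ − …" (p. 22 of arXiv:1904.04795)] -/
theorem radial_part_eq_Dz (α : ℝ) {Φ : ℝ → ℝ → ℝ} (hΦ : ContDiff ℝ 2 (uncurry Φ)) (R θ : ℝ) :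
    α ^ 2 * R ^ 2 * dz (dz Φ) R θ + α * (5 + α) * R * dz Φ R θ = α ^ 2 * (Dz^[2] Φ) R θ + 5 * α * (Dz^[1] Φ) R θ := by
  have e2 : (Dz^[2] Φ) R θ = Dz (Dz Φ) R θ := by rw [show (2 : ℕ) = 1 + 1 from rfl, Function.iterate_succ_apply']; rfl
  rw [e2, Function.iterate_one, Dz_eq_mul_dz, Dz_eq_mul_dz, dz_Dz hΦ]
  ring

/-! ### The smooth representative of `L(Ψ)` -/

section smoothRep

variable (α : ℝ) {χ : ℝ → ℝ → ℝ} {Ψ gF : ℝ → ℝ → ℝ} (hΨ : Ψ = fun R θ => Real.cos θ * χ R θ)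
  (hgF : gF = fun R θ => -α ^ 2 * R ^ 2 * dz (dz Ψ) R θ - α * (5 + α) * R * dz Ψ R θ -
      dθ (dθ Ψ) R θ + (Real.cos θ * χ R θ + Real.sin θ * dθ χ R θ) - 6 * Ψ R θ)
include hΨ hgF

/-- **`L(Ψ) = gF` on the open strip** for `Ψ = cos θχ`, `χ ∈ C²`: the `tan` term expands as
`∂_θ(tan θΨ) = Ψ/cos²θ + sin θ∂_θΨ/cos θ = cos θχ + sin θ∂_θχ`. [cite: Elgindi2021, §7 eq. (PolarBSL) (p. 19 of arXiv:1904.04795)] -/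
theorem ellipticOp_eq_smoothRep (hχ : ContDiff ℝ 2 (uncurry χ)) : ∀ p ∈ strip, ellipticOp α Ψ p.1 p.2 = gF p.1 p.2 := by
  intro p hp
  have hχ1 : ContDiff ℝ 1 (uncurry χ) := hχ.of_le (by norm_num)
  have hΨ2 : ContDiff ℝ 2 (uncurry Ψ) := by rw [hΨ]; exact contDiff_cosProfile hχ
  have hcos : Real.cos p.2 ≠ 0 := (Real.cos_pos_of_mem_Ioo ⟨by linarith [hp.2.1, Real.pi_pos], hp.2.2⟩).ne'
  have hΨp : Ψ p.1 p.2 = Real.cos p.2 * χ p.1 p.2 := by rw [hΨ]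
  have hT : Ψ p.1 p.2 / Real.cos p.2 ^ 2 + Real.sin p.2 * (-Real.sin p.2 * χ p.1 p.2 + Real.cos p.2 * dθ χ p.1 p.2) / Real.cos p.2 =
      Real.cos p.2 * χ p.1 p.2 + Real.sin p.2 * dθ χ p.1 p.2 := by
    rw [hΨp, div_add_div _ _ (pow_ne_zero 2 hcos) hcos, div_eq_iff (mul_ne_zero (pow_ne_zero 2 hcos) hcos)]
    have := Real.sin_sq_add_cos_sq p.2
    linear_combination (-(Real.cos p.2 ^ 2 * χ p.1 p.2)) * this
  have hdθp : dθ Ψ p.1 p.2 = -Real.sin p.2 * χ p.1 p.2 + Real.cos p.2 * dθ χ p.1 p.2 := by rw [hΨ, dθ_cosProfile hχ1]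
  have hud : DifferentiableAt ℝ (fun θ' => Ψ p.1 θ') p.2 :=
    ((hΨ2.comp (contDiff_const.prodMk contDiff_id)).differentiable (by simp)) p.2
  have hGp : gF p.1 p.2 = -α ^ 2 * p.1 ^ 2 * dz (dz Ψ) p.1 p.2 - α * (5 + α) * p.1 * dz Ψ p.1 p.2 -
      dθ (dθ Ψ) p.1 p.2 + (Real.cos p.2 * χ p.1 p.2 + Real.sin p.2 * dθ χ p.1 p.2) - 6 * Ψ p.1 p.2 := by rw [hgF]
  rw [hGp, ellipticOp_eq_expanded α hud hcos, hdθp, hT]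

/-- The smooth representative is `C^{n−2}` for `χ ∈ Cⁿ`. [folklore] -/
theorem contDiff_smoothRep {n : ℕ} (hχ : ContDiff ℝ ((n + 2 : ℕ) : WithTop ℕ∞) (uncurry χ)) : ContDiff ℝ (n : ℕ) (uncurry gF) := by
  have hΨc : ContDiff ℝ ((n + 2 : ℕ) : WithTop ℕ∞) (uncurry Ψ) := by rw [hΨ]; exact contDiff_cosProfile hχ
  have e1 : ((n + 2 : ℕ) : WithTop ℕ∞) = ((n + 1 : ℕ) : WithTop ℕ∞) + 1 := by push_cast; ring
  have e0 : ((n + 1 : ℕ) : WithTop ℕ∞) = ((n : ℕ) : WithTop ℕ∞) + 1 := by push_cast; ring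
  have hdzΨ : ContDiff ℝ ((n + 1 : ℕ) : WithTop ℕ∞) (uncurry (dz Ψ)) := contDiff_dz_of_contDiff (by rw [← e1]; exact hΨc)
  have hdz2Ψ : ContDiff ℝ (n : ℕ) (uncurry (dz (dz Ψ))) := contDiff_dz_of_contDiff (by rw [← e0]; exact hdzΨ)
  have hdθΨ : ContDiff ℝ ((n + 1 : ℕ) : WithTop ℕ∞) (uncurry (dθ Ψ)) := contDiff_dθ_of_contDiff (by rw [← e1]; exact hΨc)
  have hdθ2Ψ : ContDiff ℝ (n : ℕ) (uncurry (dθ (dθ Ψ))) := contDiff_dθ_of_contDiff (by rw [← e0]; exact hdθΨ)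
  have hdθχ : ContDiff ℝ ((n + 1 : ℕ) : WithTop ℕ∞) (uncurry (dθ χ)) := contDiff_dθ_of_contDiff (by rw [← e1]; exact hχ)
  have e : uncurry gF = fun p : ℝ × ℝ => -α ^ 2 * p.1 ^ 2 * uncurry (dz (dz Ψ)) p - α * (5 + α) * p.1 * uncurry (dz Ψ) p -
      uncurry (dθ (dθ Ψ)) p + (Real.cos p.2 * uncurry χ p + Real.sin p.2 * uncurry (dθ χ) p) - 6 * uncurry Ψ p := by
    funext p; rw [hgF]; rfl
  rw [e]
  have h2 := hdzΨ.of_le (show ((n : ℕ) : WithTop ℕ∞) ≤ (n + 1 : ℕ) by exact_mod_cast Nat.le_succ n)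
  have h4 := hdθχ.of_le (show ((n : ℕ) : WithTop ℕ∞) ≤ (n + 1 : ℕ) by exact_mod_cast Nat.le_succ n)
  have h5 := hχ.of_le (show ((n : ℕ) : WithTop ℕ∞) ≤ (n + 2 : ℕ) by exact_mod_cast Nat.le_add_right n 2)
  have h6 := hΨc.of_le (show ((n : ℕ) : WithTop ℕ∞) ≤ (n + 2 : ℕ) by exact_mod_cast Nat.le_add_right n 2)
  fun_prop

/-- The smooth representative is supported in the support of `χ`. [folklore] -/
theorem tsupport_smoothRep_subset : tsupport (uncurry gF) ⊆ tsupport (uncurry χ) := by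
  have hΨs : tsupport (uncurry Ψ) ⊆ tsupport (uncurry χ) := by
    refine tsupport_subset_of_eq_zero (X := uncurry χ) (g := uncurry Ψ) fun p hp => ?_
    show Ψ p.1 p.2 = 0
    rw [hΨ]; simp [show χ p.1 p.2 = 0 from hp]
  refine closure_minimal (fun p hp => ?_) (isClosed_tsupport _)
  by_contra h
  have z0 : ∀ {f : ℝ → ℝ → ℝ}, tsupport (uncurry f) ⊆ tsupport (uncurry χ) → f p.1 p.2 = 0 := by
    intro f hf
    have hnot : p ∉ tsupport (uncurry f) := fun hm => h (hf hm)
    have := image_eq_zero_of_notMem_tsupport hnot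
    exact this
  have z1 : dz (dz Ψ) p.1 p.2 = 0 := z0 ((tsupport_dz_subset.trans tsupport_dz_subset).trans hΨs)
  have z2 : dz Ψ p.1 p.2 = 0 := z0 (tsupport_dz_subset.trans hΨs)
  have z3 : dθ (dθ Ψ) p.1 p.2 = 0 := z0 (((tsupport_dθ_subset' _).trans (tsupport_dθ_subset' _)).trans hΨs)
  have z4 : χ p.1 p.2 = 0 := z0 subset_rfl
  have z5 : dθ χ p.1 p.2 = 0 := z0 (tsupport_dθ_subset' _)
  have z6 : Ψ p.1 p.2 = 0 := z0 hΨs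
  apply hp
  show gF p.1 p.2 = 0
  rw [hgF]; simp [z1, z2, z3, z4, z5, z6]

/-- The smooth representative is compactly supported. [folklore] -/
theorem hasCompactSupport_smoothRep (hs : HasCompactSupport (uncurry χ)) : HasCompactSupport (uncurry gF) :=
  HasCompactSupport.of_support_subset_isCompact hs.isCompact (subset_closure.trans (tsupport_smoothRep_subset α hΨ hgF))

end smoothRep

/-! ### The datum bound -/

/-- `(a + b + c + d)² ≤ 4(a² + b² + c² + d²)`. [folklore] -/
theorem add_four_sq_le (a b c d : ℝ) : (a + b + c + d) ^ 2 ≤ 4 * (a ^ 2 + b ^ 2 + c ^ 2 + d ^ 2) := by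
  nlinarith [sq_nonneg (a - b), sq_nonneg (a - c), sq_nonneg (a - d), sq_nonneg (b - c), sq_nonneg (b - d), sq_nonneg (c - d)]

set_option maxHeartbeats 800000 in
/-- **The datum of the level-`k` estimate for `Ψ_j = D_R^jΨ`** (see the module docstring):
`∫∫ W A_{k,j}² s^r ≤ 4∫∫ W(∂^kD_R^jgF)²s^r + 4α⁴∫∫ W(∂^kΨ_{j+2})²s^r + 100α²∫∫ W(∂^kΨ_{j+1})²s^r + 144∫∫ W(∂^kΨ_j)²s^r`.
[cite: Elgindi2021, §7.3 proof of Proposition 7.7, Steps 3–5 (p. 22 of arXiv:1904.04795)]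
[cite: ElgindiGhoulMasmoudi2021, §6, "−∂_θθΨ + ∂_θ(tan(θ)Ψ) = G, for |G|_{𝓗ᵏ} ≤ C_k|F|_{𝓗ᵏ}" (p. 15 of arXiv:1910.14071)] -/
theorem angular_data_bound (α : ℝ) (i j : ℕ) {r : ℝ} (hr0 : 0 ≤ r) {W : ℝ → ℝ} (hWc : ContinuousOn W (Ioi 0))
    (hW0 : ∀ R, 0 < R → 0 ≤ W R) {χ : ℝ → ℝ → ℝ} (hχ : ContDiff ℝ ((i + j + 4 : ℕ) : WithTop ℕ∞) (uncurry χ))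
    (hs : HasCompactSupport (uncurry χ)) (hpos : ∀ p ∈ tsupport (uncurry χ), 0 < p.1) {Ψ gF : ℝ → ℝ → ℝ}
    (hΨ : Ψ = fun R θ => Real.cos θ * χ R θ)
    (hgF : gF = fun R θ => -α ^ 2 * R ^ 2 * dz (dz Ψ) R θ - α * (5 + α) * R * dz Ψ R θ -
      dθ (dθ Ψ) R θ + (Real.cos θ * χ R θ + Real.sin θ * dθ χ R θ) - 6 * Ψ R θ) :
    (∫ p in strip, W p.1 * (-(dθ^[i + 2] (Dz^[j] Ψ)) p.1 p.2 + (dθ^[i + 1] fun R θ => Real.sin θ * (Dz^[j] χ) R θ) p.1 p.2) ^ 2 *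
        Real.sin (2 * p.2) ^ r) ≤
      4 * (∫ p in strip, W p.1 * (dθ^[i] (Dz^[j] gF)) p.1 p.2 ^ 2 * Real.sin (2 * p.2) ^ r) +
      4 * α ^ 4 * (∫ p in strip, W p.1 * (dθ^[i] (Dz^[j + 2] Ψ)) p.1 p.2 ^ 2 * Real.sin (2 * p.2) ^ r) +
      100 * α ^ 2 * (∫ p in strip, W p.1 * (dθ^[i] (Dz^[j + 1] Ψ)) p.1 p.2 ^ 2 * Real.sin (2 * p.2) ^ r) +
      144 * ∫ p in strip, W p.1 * (dθ^[i] (Dz^[j] Ψ)) p.1 p.2 ^ 2 * Real.sin (2 * p.2) ^ r := by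
  ----------------------------------------------------------------
  -- regularity
  ----------------------------------------------------------------
  have hΨc : ContDiff ℝ ((i + j + 4 : ℕ) : WithTop ℕ∞) (uncurry Ψ) := by rw [hΨ]; exact contDiff_cosProfile hχ
  have hΨs : HasCompactSupport (uncurry Ψ) := by rw [hΨ]; exact hasCompactSupport_cosProfile hs
  have hΨsub : tsupport (uncurry Ψ) ⊆ tsupport (uncurry χ) := by
    refine tsupport_subset_of_eq_zero (X := uncurry χ) (g := uncurry Ψ) fun p hp => ?_
    show Ψ p.1 p.2 = 0
    rw [hΨ]; simp [show χ p.1 p.2 = 0 from hp]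
  -- `Ψ_m = D_R^mΨ ∈ C^{i+j+4−m}`
  have hΨm : ∀ m, m ≤ j + 2 → ContDiff ℝ ((i + j + 4 - m : ℕ) : WithTop ℕ∞) (uncurry (Dz^[m] Ψ)) := by
    intro m hm
    refine contDiff_iterate_Dz_of_contDiff (m := m) (n := i + j + 4 - m) ?_
    have e : ((i + j + 4 - m + m : ℕ) : WithTop ℕ∞) = ((i + j + 4 : ℕ) : WithTop ℕ∞) := by rw [Nat.sub_add_cancel (by omega)]
    exact_mod_cast (e ▸ hΨc : ContDiff ℝ ((i + j + 4 - m + m : ℕ) : WithTop ℕ∞) (uncurry Ψ))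
  have hχj : ContDiff ℝ ((i + 4 : ℕ) : WithTop ℕ∞) (uncurry (Dz^[j] χ)) := by
    refine contDiff_iterate_Dz_of_contDiff (m := j) (n := i + 4) ?_
    have e : ((i + 4 + j : ℕ) : WithTop ℕ∞) = ((i + j + 4 : ℕ) : WithTop ℕ∞) := by push_cast; ring
    exact_mod_cast (e ▸ hχ : ContDiff ℝ ((i + 4 + j : ℕ) : WithTop ℕ∞) (uncurry χ))
  have hχj2 : ContDiff ℝ ((i + 2 : ℕ) : WithTop ℕ∞) (uncurry (Dz^[j] χ)) := hχj.of_le (by exact_mod_cast (show i + 2 ≤ i + 4 by omega))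
  have hΨj : Dz^[j] Ψ = fun R θ => Real.cos θ * (Dz^[j] χ) R θ := by
    rw [hΨ]; exact iterate_Dz_cosProfile j (hχ.of_le (by exact_mod_cast (show j ≤ i + j + 4 by omega)))
  -- the smooth representative and its iterate
  have hχ2 : ContDiff ℝ (((i + j + 2) + 2 : ℕ) : WithTop ℕ∞) (uncurry χ) := by
    have e : i + j + 2 + 2 = i + j + 4 := by ring
    rw [e]; exact hχ
  have hgFc : ContDiff ℝ ((i + j + 2 : ℕ) : WithTop ℕ∞) (uncurry gF) := contDiff_smoothRep α hΨ hgF hχ2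
  have hgFs : HasCompactSupport (uncurry gF) := hasCompactSupport_smoothRep α hΨ hgF hs
  have hgFsub : tsupport (uncurry gF) ⊆ tsupport (uncurry χ) := tsupport_smoothRep_subset α hΨ hgF
  have hFj : ContDiff ℝ ((i + 2 : ℕ) : WithTop ℕ∞) (uncurry (Dz^[j] gF)) := by
    refine contDiff_iterate_Dz_of_contDiff (m := j) (n := i + 2) ?_
    have e : ((i + 2 + j : ℕ) : WithTop ℕ∞) = ((i + j + 2 : ℕ) : WithTop ℕ∞) := by push_cast; ring
    exact_mod_cast (e ▸ hgFc : ContDiff ℝ ((i + 2 + j : ℕ) : WithTop ℕ∞) (uncurry gF))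
  -- orders `i` of the four pieces
  have hFi : ContDiff ℝ (i : ℕ) (uncurry (Dz^[j] gF)) := hFj.of_le (by exact_mod_cast Nat.le_add_right i 2)
  have hΨj2i : ContDiff ℝ (i : ℕ) (uncurry (Dz^[j + 2] Ψ)) :=
    (hΨm (j + 2) le_rfl).of_le (by exact_mod_cast (show i ≤ i + j + 4 - (j + 2) by omega))
  have hΨj1i : ContDiff ℝ (i : ℕ) (uncurry (Dz^[j + 1] Ψ)) :=
    (hΨm (j + 1) (Nat.le_succ _)).of_le (by exact_mod_cast (show i ≤ i + j + 4 - (j + 1) by omega))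
  have hΨji : ContDiff ℝ (i : ℕ) (uncurry (Dz^[j] Ψ)) :=
    (hΨm j (by omega)).of_le (by exact_mod_cast (show i ≤ i + j + 4 - j by omega))
  have hΨj2 : ContDiff ℝ 2 (uncurry (Dz^[j] Ψ)) := (hΨm j (by omega)).of_le (by exact_mod_cast (show 2 ≤ i + j + 4 - j by omega))
  have hΨ3j : ContDiff ℝ ((j + 3 : ℕ) : WithTop ℕ∞) (uncurry Ψ) := hΨc.of_le (by exact_mod_cast (show j + 3 ≤ i + j + 4 by omega))
  ----------------------------------------------------------------
  -- `A = ∂^i G'` on the strip, `G' = D_R^j gF + α²Ψ_{j+2} + 5αΨ_{j+1} + 6Ψ_j`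
  ----------------------------------------------------------------
  obtain ⟨G', hG'⟩ : ∃ G' : ℝ → ℝ → ℝ, G' = fun R θ => (Dz^[j] gF) R θ + α ^ 2 * (Dz^[j + 2] Ψ) R θ + 5 * α * (Dz^[j + 1] Ψ) R θ +
      6 * (Dz^[j] Ψ) R θ := ⟨_, rfl⟩
  have hGG' : ∀ q ∈ strip, (fun R θ => ellipticOp α (Dz^[j] Ψ) R θ + α ^ 2 * R ^ 2 * dz (dz (Dz^[j] Ψ)) R θ +
      α * (5 + α) * R * dz (Dz^[j] Ψ) R θ + 6 * (Dz^[j] Ψ) R θ) q.1 q.2 = G' q.1 q.2 := by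
    intro q hq
    rw [hG']
    simp only []
    have h1 : ellipticOp α (Dz^[j] Ψ) q.1 q.2 = (Dz^[j] gF) q.1 q.2 := by
      rw [ellipticOp_iterate_Dz α j hΨ3j q hq]
      exact iterate_Dz_congr (ellipticOp_eq_smoothRep α hΨ hgF (hχ.of_le (by exact_mod_cast (show 2 ≤ i + j + 4 by omega)))) j q hq
    have h2 := radial_part_eq_Dz α hΨj2 q.1 q.2
    have e2 : (Dz^[2] (Dz^[j] Ψ)) q.1 q.2 = (Dz^[j + 2] Ψ) q.1 q.2 := by rw [← Function.iterate_add_apply, add_comm]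
    have e1 : (Dz^[1] (Dz^[j] Ψ)) q.1 q.2 = (Dz^[j + 1] Ψ) q.1 q.2 := by rw [← Function.iterate_add_apply, add_comm]
    rw [e2, e1] at h2
    linear_combination h1 + h2
  have hA : ∀ q ∈ strip, -(dθ^[i + 2] (Dz^[j] Ψ)) q.1 q.2 + (dθ^[i + 1] fun R θ => Real.sin θ * (Dz^[j] χ) R θ) q.1 q.2 =
      (dθ^[i] (Dz^[j] gF)) q.1 q.2 + α ^ 2 * (dθ^[i] (Dz^[j + 2] Ψ)) q.1 q.2 + 5 * α * (dθ^[i] (Dz^[j + 1] Ψ)) q.1 q.2 +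
      6 * (dθ^[i] (Dz^[j] Ψ)) q.1 q.2 := by
    intro q hq
    rw [iterate_dθ_angular_eq α i hχj2 hΨj hq,
      iterate_dθ_congr (f := fun R θ => ellipticOp α (Dz^[j] Ψ) R θ + α ^ 2 * R ^ 2 * dz (dz (Dz^[j] Ψ)) R θ +
        α * (5 + α) * R * dz (Dz^[j] Ψ) R θ + 6 * (Dz^[j] Ψ) R θ) (g := G') hGG' i q hq, hG']
    -- linearity (all four pieces are `Cⁱ`)
    have hB : ContDiff ℝ (i : ℕ) (uncurry fun R θ => α ^ 2 * (Dz^[j + 2] Ψ) R θ) := by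
      have e : uncurry (fun R θ => α ^ 2 * (Dz^[j + 2] Ψ) R θ) = fun p => α ^ 2 * uncurry (Dz^[j + 2] Ψ) p := by funext p; rfl
      rw [e]; exact contDiff_const.mul hΨj2i
    have hC : ContDiff ℝ (i : ℕ) (uncurry fun R θ => 5 * α * (Dz^[j + 1] Ψ) R θ) := by
      have e : uncurry (fun R θ => 5 * α * (Dz^[j + 1] Ψ) R θ) = fun p => 5 * α * uncurry (Dz^[j + 1] Ψ) p := by funext p; rfl
      rw [e]; exact contDiff_const.mul hΨj1i
    have hD : ContDiff ℝ (i : ℕ) (uncurry fun R θ => 6 * (Dz^[j] Ψ) R θ) := by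
      have e : uncurry (fun R θ => 6 * (Dz^[j] Ψ) R θ) = fun p => 6 * uncurry (Dz^[j] Ψ) p := by funext p; rfl
      rw [e]; exact contDiff_const.mul hΨji
    have hAB : ContDiff ℝ (i : ℕ) (uncurry fun R θ => (Dz^[j] gF) R θ + α ^ 2 * (Dz^[j + 2] Ψ) R θ) := by
      have e : uncurry (fun R θ => (Dz^[j] gF) R θ + α ^ 2 * (Dz^[j + 2] Ψ) R θ) = fun p => uncurry (Dz^[j] gF) p + α ^ 2 * uncurry (Dz^[j + 2] Ψ) p := by
        funext p; rfl
      rw [e]; exact hFi.add (contDiff_const.mul hΨj2i)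
    have hABC : ContDiff ℝ (i : ℕ) (uncurry fun R θ => (Dz^[j] gF) R θ + α ^ 2 * (Dz^[j + 2] Ψ) R θ + 5 * α * (Dz^[j + 1] Ψ) R θ) := by
      have e : uncurry (fun R θ => (Dz^[j] gF) R θ + α ^ 2 * (Dz^[j + 2] Ψ) R θ + 5 * α * (Dz^[j + 1] Ψ) R θ) =
          fun p => uncurry (Dz^[j] gF) p + α ^ 2 * uncurry (Dz^[j + 2] Ψ) p + 5 * α * uncurry (Dz^[j + 1] Ψ) p := by funext p; rfl
      rw [e]; exact (hFi.add (contDiff_const.mul hΨj2i)).add (contDiff_const.mul hΨj1i)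
    rw [iterate_dθ_add hABC hD, iterate_dθ_add hAB hC, iterate_dθ_add hFi hB, iterate_dθ_smul, iterate_dθ_smul, iterate_dθ_smul]
  ----------------------------------------------------------------
  -- integrability of the pieces
  ----------------------------------------------------------------
  have cont_i : ∀ {g : ℝ → ℝ → ℝ}, ContDiff ℝ (i : ℕ) (uncurry g) → Continuous fun p : ℝ × ℝ => (dθ^[i] g) p.1 p.2 := by
    intro g hg
    exact (contDiff_iterate_dθ_of_contDiff (n := i) (m := 0) (by simpa using hg)).continuous
  have supp_i : ∀ {g : ℝ → ℝ → ℝ}, HasCompactSupport (uncurry g) → tsupport (uncurry g) ⊆ tsupport (uncurry χ) →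
      HasCompactSupport (fun p : ℝ × ℝ => (dθ^[i] g) p.1 p.2 ^ 2) ∧ ∀ p ∈ tsupport (fun p : ℝ × ℝ => (dθ^[i] g) p.1 p.2 ^ 2), 0 < p.1 := by
    intro g hg hsub
    have h1 : HasCompactSupport (uncurry (dθ^[i] g)) := hasCompactSupport_iterate_dθ hg i
    have h2 : tsupport (fun p : ℝ × ℝ => (dθ^[i] g) p.1 p.2 ^ 2) ⊆ tsupport (uncurry χ) :=
      (tsupport_subset_of_eq_zero (X := uncurry (dθ^[i] g)) fun p hp => by simp [show (dθ^[i] g) p.1 p.2 = 0 from hp]).trans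
        ((tsupport_iterate_dθ_subset i).trans hsub)
    exact ⟨hasCompactSupport_of_eq_zero h1 fun p hp => by simp [show (dθ^[i] g) p.1 p.2 = 0 from hp], fun p hp => hpos p (h2 hp)⟩
  have hFsub : tsupport (uncurry (Dz^[j] gF)) ⊆ tsupport (uncurry χ) := (tsupport_iterate_Dz_subset j).trans hgFsub
  have hΨsub' : ∀ m, tsupport (uncurry (Dz^[m] Ψ)) ⊆ tsupport (uncurry χ) := fun m => (tsupport_iterate_Dz_subset m).trans hΨsub
  have iF : Integrable fun p : ℝ × ℝ => W p.1 * (dθ^[i] (Dz^[j] gF)) p.1 p.2 ^ 2 * Real.sin (2 * p.2) ^ r :=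
    integrable_weight_mul_rpow hWc (by have := cont_i hFi; fun_prop) (supp_i (hasCompactSupport_iterate_Dz hgFs j) hFsub).1
      (supp_i (hasCompactSupport_iterate_Dz hgFs j) hFsub).2 hr0
  have iB : Integrable fun p : ℝ × ℝ => W p.1 * (dθ^[i] (Dz^[j + 2] Ψ)) p.1 p.2 ^ 2 * Real.sin (2 * p.2) ^ r :=
    integrable_weight_mul_rpow hWc (by have := cont_i hΨj2i; fun_prop) (supp_i (hasCompactSupport_iterate_Dz hΨs (j + 2)) (hΨsub' _)).1
      (supp_i (hasCompactSupport_iterate_Dz hΨs (j + 2)) (hΨsub' _)).2 hr0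
  have iC : Integrable fun p : ℝ × ℝ => W p.1 * (dθ^[i] (Dz^[j + 1] Ψ)) p.1 p.2 ^ 2 * Real.sin (2 * p.2) ^ r :=
    integrable_weight_mul_rpow hWc (by have := cont_i hΨj1i; fun_prop) (supp_i (hasCompactSupport_iterate_Dz hΨs (j + 1)) (hΨsub' _)).1
      (supp_i (hasCompactSupport_iterate_Dz hΨs (j + 1)) (hΨsub' _)).2 hr0
  have iD : Integrable fun p : ℝ × ℝ => W p.1 * (dθ^[i] (Dz^[j] Ψ)) p.1 p.2 ^ 2 * Real.sin (2 * p.2) ^ r :=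
    integrable_weight_mul_rpow hWc (by have := cont_i hΨji; fun_prop) (supp_i (hasCompactSupport_iterate_Dz hΨs j) (hΨsub' _)).1
      (supp_i (hasCompactSupport_iterate_Dz hΨs j) (hΨsub' _)).2 hr0
  -- the left-hand side integrand, through its strip representative
  obtain ⟨A, hAdef⟩ : ∃ A : ℝ × ℝ → ℝ, A = fun p => -(dθ^[i + 2] (Dz^[j] Ψ)) p.1 p.2 + (dθ^[i + 1] fun R θ => Real.sin θ * (Dz^[j] χ) R θ) p.1 p.2 := ⟨_, rfl⟩
  obtain ⟨B, hBdef⟩ : ∃ B : ℝ × ℝ → ℝ, B = fun p => (dθ^[i] (Dz^[j] gF)) p.1 p.2 + α ^ 2 * (dθ^[i] (Dz^[j + 2] Ψ)) p.1 p.2 +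
      5 * α * (dθ^[i] (Dz^[j + 1] Ψ)) p.1 p.2 + 6 * (dθ^[i] (Dz^[j] Ψ)) p.1 p.2 := ⟨_, rfl⟩
  have hAB' : ∀ q ∈ strip, A q = B q := fun q hq => by rw [hAdef, hBdef]; exact hA q hq
  have eLHS : (∫ p in strip, W p.1 * (-(dθ^[i + 2] (Dz^[j] Ψ)) p.1 p.2 + (dθ^[i + 1] fun R θ => Real.sin θ * (Dz^[j] χ) R θ) p.1 p.2) ^ 2 *
      Real.sin (2 * p.2) ^ r) = ∫ p in strip, W p.1 * B p ^ 2 * Real.sin (2 * p.2) ^ r := by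
    refine setIntegral_congr_fun measurableSet_strip fun q hq => ?_
    have := hAB' q hq
    rw [hAdef] at this
    simp only [] at this ⊢
    rw [this]
  rw [eLHS]
  -- integrability of `W B² s^r`: `B²` is continuous, compactly supported inside `R > 0`
  have cB : Continuous B := by
    rw [hBdef]
    have := cont_i hFi; have := cont_i hΨj2i; have := cont_i hΨj1i; have := cont_i hΨji
    fun_prop
  have sB : HasCompactSupport (fun p => B p ^ 2) ∧ ∀ p ∈ tsupport (fun p => B p ^ 2), 0 < p.1 := by
    have hzero : ∀ p : ℝ × ℝ, p ∉ tsupport (uncurry χ) → B p = 0 := by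
      intro p hp
      have z : ∀ {g : ℝ → ℝ → ℝ}, tsupport (uncurry g) ⊆ tsupport (uncurry χ) → (dθ^[i] g) p.1 p.2 = 0 := by
        intro g hg
        have hnot : p ∉ tsupport (uncurry (dθ^[i] g)) := fun hm => hp (((tsupport_iterate_dθ_subset i).trans hg) hm)
        have := image_eq_zero_of_notMem_tsupport hnot
        exact this
      rw [hBdef]; simp only []
      rw [z hFsub, z (hΨsub' _), z (hΨsub' _), z (hΨsub' _)]; ring
    have hsub : tsupport (fun p => B p ^ 2) ⊆ tsupport (uncurry χ) := by
      refine closure_minimal (fun p hp => ?_) (isClosed_tsupport _)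
      by_contra h
      exact hp (by simp [hzero p h])
    exact ⟨HasCompactSupport.of_support_subset_isCompact hs.isCompact (subset_closure.trans hsub), fun p hp => hpos p (hsub hp)⟩
  have iBB : Integrable fun p : ℝ × ℝ => W p.1 * B p ^ 2 * Real.sin (2 * p.2) ^ r :=
    integrable_weight_mul_rpow hWc (by fun_prop) sB.1 sB.2 hr0
  -- pointwise bound and integration
  have iR : Integrable fun p : ℝ × ℝ => 4 * (W p.1 * (dθ^[i] (Dz^[j] gF)) p.1 p.2 ^ 2 * Real.sin (2 * p.2) ^ r) +
      4 * α ^ 4 * (W p.1 * (dθ^[i] (Dz^[j + 2] Ψ)) p.1 p.2 ^ 2 * Real.sin (2 * p.2) ^ r) +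
      100 * α ^ 2 * (W p.1 * (dθ^[i] (Dz^[j + 1] Ψ)) p.1 p.2 ^ 2 * Real.sin (2 * p.2) ^ r) +
      144 * (W p.1 * (dθ^[i] (Dz^[j] Ψ)) p.1 p.2 ^ 2 * Real.sin (2 * p.2) ^ r) :=
    (((iF.const_mul _).add (iB.const_mul _)).add (iC.const_mul _)).add (iD.const_mul _)
  have hmono := setIntegral_mono_on (s := strip) iBB.integrableOn iR.integrableOn measurableSet_strip fun p hp => by
    have hw := hW0 p.1 hp.1
    have hρ : 0 ≤ Real.sin (2 * p.2) ^ r :=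
      Real.rpow_nonneg (Real.sin_pos_of_pos_of_lt_pi (by linarith [hp.2.1]) (by linarith [hp.2.2])).le _
    have h4 := add_four_sq_le ((dθ^[i] (Dz^[j] gF)) p.1 p.2) (α ^ 2 * (dθ^[i] (Dz^[j + 2] Ψ)) p.1 p.2)
      (5 * α * (dθ^[i] (Dz^[j + 1] Ψ)) p.1 p.2) (6 * (dθ^[i] (Dz^[j] Ψ)) p.1 p.2)
    have eB : B p = (dθ^[i] (Dz^[j] gF)) p.1 p.2 + α ^ 2 * (dθ^[i] (Dz^[j + 2] Ψ)) p.1 p.2 + 5 * α * (dθ^[i] (Dz^[j + 1] Ψ)) p.1 p.2 +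
        6 * (dθ^[i] (Dz^[j] Ψ)) p.1 p.2 := by rw [hBdef]
    rw [eB]
    have := mul_le_mul_of_nonneg_left h4 (mul_nonneg hw hρ)
    nlinarith [this]
  refine hmono.trans (le_of_eq ?_)
  have k1 : Integrable fun p : ℝ × ℝ => 4 * (W p.1 * (dθ^[i] (Dz^[j] gF)) p.1 p.2 ^ 2 * Real.sin (2 * p.2) ^ r) +
      4 * α ^ 4 * (W p.1 * (dθ^[i] (Dz^[j + 2] Ψ)) p.1 p.2 ^ 2 * Real.sin (2 * p.2) ^ r) := (iF.const_mul _).add (iB.const_mul _)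
  have k2 : Integrable fun p : ℝ × ℝ => 4 * (W p.1 * (dθ^[i] (Dz^[j] gF)) p.1 p.2 ^ 2 * Real.sin (2 * p.2) ^ r) +
      4 * α ^ 4 * (W p.1 * (dθ^[i] (Dz^[j + 2] Ψ)) p.1 p.2 ^ 2 * Real.sin (2 * p.2) ^ r) +
      100 * α ^ 2 * (W p.1 * (dθ^[i] (Dz^[j + 1] Ψ)) p.1 p.2 ^ 2 * Real.sin (2 * p.2) ^ r) := k1.add (iC.const_mul _)
  rw [integral_add k2.integrableOn (iD.const_mul _).integrableOn, integral_add k1.integrableOn (iC.const_mul _).integrableOn,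
    integral_add (iF.const_mul _).integrableOn (iB.const_mul _).integrableOn, MeasureTheory.integral_const_mul,
    MeasureTheory.integral_const_mul, MeasureTheory.integral_const_mul, MeasureTheory.integral_const_mul]

end Elgindi

end Literature.Analysis.FluidPDE
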